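import Literature.NumberTheory.ConnesConsani2021.QuasiInnerLocalFactors
import Mathlib.Topology.Algebra.Module.FiniteDimension
import HarnessLib

/-!
# Connes–Consani 2021 (JNT) §3 — Fact 3.6 («`ρ_p` is not quasi-inner») from Lemma 3.5 (PROVED reduction)

LINE 1 — LABEL: RH-FREE corpus literature (operator theory of the Hankel-type operator `(1 − 𝒫)κ_p𝒫` on
`L²(S¹)`; no positivity statement, no statement about zeros of `ζ`); bears_on: W-C/W-P (sequel typing, no
leaf role); WHAT THIS IS NOT: any claim about RH — nothing in this file bears on the truth of RH.

Source: A. Connes, C. Consani, *Quasi-inner functions and local factors*, J. Number Theory **226** (2021)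
139–167 = arXiv:2008.10974 [bib: `ConnesConsani2021QuasiInner`]; locators are arXiv tex chunks
`pNNNN:Lnn`.  Companion of `QuasiInnerLocalFactors.lean` (cell rh-crit/cc, seat t17), same namespace
`Literature.NumberTheory.ConnesConsani2021.QuasiInner`; THEOREMS ONLY (no definition, no named fact).

Content (RH-FREE).  Fact 3.6 («The function `ρ_p` is not quasi-inner», p0009:L34–L36) is printed as a
consequence of Lemma 3.5: «This shows that the operator `(1 − 𝒫)κ_p𝒫` has the same strength as the
operator `BIB : ℓ²(ℤ) → ℓ²(ℤ)` and hence that it is not a compact operator».  This file PROVES that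
deduction as `fact_3_6_of_lemma_3_5 : lemma_3_5 → fact_3_6`: with `B` the (invertible, positive) operator
of Lemma 3.3 (`lemma33Model`, `IsLemma33Operator.isUnit`, landed), `V = UB` with `U` an isometry
(Lemma 3.4, `lemma_3_4_holds`, landed), `I` the flip `δ_n ↦ δ_{−n}` (an isometry) and `U_±` the Hardy
isometries, Lemma 3.5 reads `(1 − 𝒫)κ_p𝒫 = ((1−p)/p) U_− U B I B U^* U_+^*`; compactness of the left side
would give, after multiplying by the adjoint isometries and by `B⁻¹`, compactness of `I`, hence of
`I^*I = 1_{ℓ²(ℤ)}`, hence (Riesz) `dim ℓ²(ℤ) < ∞` — contradicting the infinite-dimensional range of `U`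
(Lemma 3.4).  Clauses 1–2 of the typed `fact_3_6` (the boundary function of `κ_p` is in `L^∞` and
unimodular) are the landed `memLp_circleRestrict_kappaPrime`.  When `lemma_3_5_holds` lands (seat t5),
`fact_3_6_holds` is the one-liner `fact_3_6_of_lemma_3_5 lemma_3_5_holds`.

Nothing in this file bears on the truth of RH.
-/

noncomputable section

open _root_.MeasureTheory _root_.Complex AddCircle Filter Set
open scoped Real ENNReal InnerProductSpace Topology ComplexConjugate

namespace Literature.NumberTheory.ConnesConsani2021

namespace QuasiInner

section FactThreeSix

/-- RH-FREE. The flipped unit vectors `δ_{−n} ∈ ℓ²(ℤ)` form an orthonormal family. [folklore] -/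
private theorem f36_orthonormal_single_neg :
    Orthonormal ℂ (fun n : ℤ => (lp.single 2 (-n) (1 : ℂ) : (lp (fun _ : ℤ => ℂ) 2))) := by
  rw [orthonormal_iff_ite]
  intro m n
  rw [lp.inner_single_left, lp.single_apply]
  by_cases h : m = n
  · subst h; simp
  · simp [h]

/-- RH-FREE. **Fact 3.6 from Lemma 3.5** («This shows that the operator `(1 − 𝒫)κ_p𝒫` has the same
strength as the operator `BIB : ℓ²(ℤ) → ℓ²(ℤ)` and hence that it is not a compact operator … The function
`ρ_p` is not quasi-inner»): PROVED reduction — `B` invertible (Lemma 3.3), `V = UB` with `U` an isometry of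
infinite-dimensional range (Lemma 3.4), `I`, `U_±` isometries; a compact `(1 − 𝒫)κ_p𝒫 =
((1−p)/p)U_−VIV^*U_+^*` would make `I = B⁻¹(U^*U_−^*[(1−𝒫)κ_p𝒫]U_+U)B⁻¹·p/(1−p)` compact, hence
`1 = I^*I` compact, hence `ℓ²(ℤ)` finite-dimensional (Riesz), absurd.
[cite: ConnesConsani2021QuasiInner, Fact 3.6 «factnq» with the sentence before it (arXiv chunk p0009:L32–L36)] -/
theorem fact_3_6_of_lemma_3_5 (h35 : lemma_3_5) : fact_3_6 := by
  intro p hp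
  obtain ⟨hmem, hae, -⟩ := memLp_circleRestrict_kappaPrime hp.one_lt
  refine ⟨hmem, hae, fun hA => ?_⟩
  -- the operators of Lemmas 3.3–3.5
  have hB : IsLemma33Operator p (lemma33Model p hp.one_lt) := isLemma33Operator_lemma33Model hp
  set B : lp (fun _ : ℤ => ℂ) 2 →L[ℂ] lp (fun _ : ℤ => ℂ) 2 := lemma33Model p hp.one_lt with hBdef
  obtain ⟨V, U, hV, hUB, -, hinf⟩ := lemma_3_4_holds p hp B hB
  set Iiso : lp (fun _ : ℤ => ℂ) 2 →ₗᵢ[ℂ] lp (fun _ : ℤ => ℂ) 2 :=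
    f36_orthonormal_single_neg.orthogonalFamily.linearIsometry with hIiso
  set Iop : lp (fun _ : ℤ => ℂ) 2 →L[ℂ] lp (fun _ : ℤ => ℂ) 2 := Iiso.toContinuousLinearMap with hIop
  have hI : ∀ n : ℤ, Iop (lp.single 2 n (1 : ℂ)) = lp.single 2 (-n) (1 : ℂ) := by
    intro n
    classical
    rw [hIop, LinearIsometry.coe_toContinuousLinearMap, hIiso,
      OrthogonalFamily.linearIsometry_apply_single]
    simp
  set A := hardyOffDiag 1 (toLpOrZero ∞ haarAddCircle (circleRestrict 1 (kappaPrime p))) with hAdef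
  set Um : lp (fun _ : ℕ => ℂ) 2 →L[ℂ] Lp ℂ 2 (haarAddCircle (T := 1)) :=
    (hardyIsoMinus 1).toContinuousLinearMap with hUm
  set Up : lp (fun _ : ℕ => ℂ) 2 →L[ℂ] Lp ℂ 2 (haarAddCircle (T := 1)) :=
    (hardyIsoPlus 1).toContinuousLinearMap with hUp
  set c : ℂ := ((((1 - (p : ℝ)) / p : ℝ)) : ℂ) with hc
  have hc0 : c ≠ 0 := by
    rw [hc]
    have hp2 : (2 : ℝ) ≤ p := by exact_mod_cast hp.two_le
    have : ((1 - (p : ℝ)) / p : ℝ) < 0 := div_neg_of_neg_of_pos (by linarith) (by linarith)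
    exact_mod_cast this.ne
  -- Lemma 3.5
  have h : A = c • (Um ∘L V ∘L Iop ∘L ContinuousLinearMap.adjoint V ∘L ContinuousLinearMap.adjoint Up) :=
    h35 p hp V Iop hV hI
  -- isometries: `W^* W = 1`
  have hUm1 : ∀ y, ContinuousLinearMap.adjoint Um (Um y) = y := fun y => by
    have e := DFunLike.congr_fun (hardyIsoMinus (1 : ℝ)).adjoint_comp_self y
    rw [ContinuousLinearMap.comp_apply, one_apply_eq_self] at e
    exact e
  have hUp1 : ∀ y, ContinuousLinearMap.adjoint Up (Up y) = y := fun y => by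
    have e := DFunLike.congr_fun (hardyIsoPlus (1 : ℝ)).adjoint_comp_self y
    rw [ContinuousLinearMap.comp_apply, one_apply_eq_self] at e
    exact e
  have hU1 : ∀ y, ContinuousLinearMap.adjoint U.toContinuousLinearMap (U y) = y := fun y => by
    have e := DFunLike.congr_fun U.adjoint_comp_self y
    rw [ContinuousLinearMap.comp_apply, one_apply_eq_self] at e
    exact e
  have hI1 : ∀ y, ContinuousLinearMap.adjoint Iop (Iop y) = y := fun y => by
    have e := DFunLike.congr_fun Iiso.adjoint_comp_self y
    rw [ContinuousLinearMap.comp_apply, one_apply_eq_self] at e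
    exact e
  -- `V = U B`, `V^* = B U^*` (`B` is self-adjoint)
  have hBsa : ContinuousLinearMap.adjoint B = B := hB.1.isSelfAdjoint.adjoint_eq
  have hVx : ∀ x, V x = U (B x) := fun x => by
    rw [← hUB]; rfl
  have hVadj : ContinuousLinearMap.adjoint V = B ∘L ContinuousLinearMap.adjoint U.toContinuousLinearMap := by
    rw [← hUB, ContinuousLinearMap.adjoint_comp, hBsa]
  -- Step 1: `U_−^* A U_+ = c · V I V^*` is compact
  have hT : ∀ x, ContinuousLinearMap.adjoint Um (A (Up x)) =
      c • V (Iop (ContinuousLinearMap.adjoint V x)) := by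
    intro x
    rw [h]
    simp only [FunLike.coe_smul, Pi.smul_apply, ContinuousLinearMap.comp_apply, hUp1, map_smul,
      hUm1]
  have hTc : IsCompactOperator (fun x => c • V (Iop (ContinuousLinearMap.adjoint V x))) := by
    have h1 : IsCompactOperator (fun x => ContinuousLinearMap.adjoint Um (A (Up x))) :=
      (hA.clm_comp (ContinuousLinearMap.adjoint Um)).comp_clm Up
    refine (funext hT ▸ h1 :)
  -- Step 2: remove the scalar and conjugate by `U`: `B I B` is compact
  have hBIB : IsCompactOperator (fun x => B (Iop (B x))) := by
    have h2 : IsCompactOperator (fun x => V (Iop (ContinuousLinearMap.adjoint V x))) := by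
      have := hTc.smul c⁻¹
      refine (?_ : (fun x => V (Iop (ContinuousLinearMap.adjoint V x))) =
        c⁻¹ • fun x => c • V (Iop (ContinuousLinearMap.adjoint V x))) ▸ this
      funext x
      simp [smul_smul, inv_mul_cancel₀ hc0]
    -- as a continuous linear map
    have h3 : IsCompactOperator (⇑(V ∘L Iop ∘L ContinuousLinearMap.adjoint V)) := h2
    have h4 := (h3.clm_comp (ContinuousLinearMap.adjoint U.toContinuousLinearMap)).comp_clm
      U.toContinuousLinearMap
    refine (?_ : (fun x => B (Iop (B x))) = _) ▸ h4
    funext x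
    simp only [Function.comp_apply, ContinuousLinearMap.comp_apply, hVadj, hVx, hU1,
      LinearIsometry.coe_toContinuousLinearMap]
  -- Step 3: `B` is invertible, so `I` is compact
  have hIc : IsCompactOperator (⇑Iop) := by
    obtain ⟨u, hu⟩ := IsLemma33Operator.isUnit hp hB
    have hinv1 : ∀ x, (↑u⁻¹ : lp (fun _ : ℤ => ℂ) 2 →L[ℂ] lp (fun _ : ℤ => ℂ) 2) (B x) = x := fun x => by
      have := congrArg (fun T : lp (fun _ : ℤ => ℂ) 2 →L[ℂ] lp (fun _ : ℤ => ℂ) 2 => T x) u.inv_mul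
      simpa [hu] using this
    have hinv2 : ∀ x, B ((↑u⁻¹ : lp (fun _ : ℤ => ℂ) 2 →L[ℂ] lp (fun _ : ℤ => ℂ) 2) x) = x := fun x => by
      have := congrArg (fun T : lp (fun _ : ℤ => ℂ) 2 →L[ℂ] lp (fun _ : ℤ => ℂ) 2 => T x) u.mul_inv
      simpa [hu] using this
    have h5 := (hBIB.clm_comp (↑u⁻¹ : lp (fun _ : ℤ => ℂ) 2 →L[ℂ] lp (fun _ : ℤ => ℂ) 2)).comp_clm
      (↑u⁻¹ : lp (fun _ : ℤ => ℂ) 2 →L[ℂ] lp (fun _ : ℤ => ℂ) 2)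
    refine (?_ : (⇑Iop) = _) ▸ h5
    funext x
    simp only [Function.comp_apply, hinv2, hinv1]
  -- Step 4: `I^* I = 1` is compact, so `ℓ²(ℤ)` is finite-dimensional (Riesz): contradiction
  have hid : IsCompactOperator (id : lp (fun _ : ℤ => ℂ) 2 → lp (fun _ : ℤ => ℂ) 2) := by
    have h6 := hIc.clm_comp (ContinuousLinearMap.adjoint Iop)
    refine (?_ : (id : lp (fun _ : ℤ => ℂ) 2 → lp (fun _ : ℤ => ℂ) 2) = _) ▸ h6
    funext x
    simp only [Function.comp_apply, hI1, id]
  haveI : LocallyCompactSpace (lp (fun _ : ℤ => ℂ) 2) := LocallyCompactSpace.of_isCompactOperator_id hid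
  haveI : FiniteDimensional ℂ (lp (fun _ : ℤ => ℂ) 2) := FiniteDimensional.of_locallyCompactSpace ℂ
  exact hinf inferInstance

end FactThreeSix

end QuasiInner

end Literature.NumberTheory.ConnesConsani2021
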